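import Literature.NumberTheory.Sieve.Maynard2016Prop92LocalPairSumTotal
import HarnessLib

/-!
# Maynard 2016, Lemma 9.3 for `𝒜 = ℤ` — step 1: `y^{(m)}` in terms of `y` (displays (9.23)–(9.24))

Sources: J. Maynard, *Dense clusters of primes in subsets*, Compositio Math. 152 (2016) 1517–1554 =
arXiv:1405.2593 [Maynard2016DenseClusters], proof of Lemma 9.3, p. 23 (displays (9.23)–(9.24));
K. Ford, B. Green, S. Konyagin, J. Maynard, T. Tao, *Long gaps between primes*, JAMS 31 (2018)
[FordGreenKonyaginMaynardTao2018], Theorem 6 (7.13).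

The first (exact) step of the shared sub-leaf M2 `Maynard2016Lemma93Z` of
`Maynard2016Prop92MainDecomposition`: substituting the definition (8.6) of `λ_d` in terms of the
variables `y_e` into the definition (9.10) of `y^{(m)}_r` and evaluating the inner divisor sum.
For `r ∈ dkBoxP` (i.e. `r ∈ 𝒟'_k`, `r_m = 1`, `(r_j, a_j b_m − a_m b_j) = 1`):

* `innerDSumM_eq` — `∑_{d ∈ 𝒟'_k, r ∣ d ∣ e, d_m = 1} μ(d) d/φ_L(d) = μ(r) r/φ_L(r) ∏_j ∏_{p ∣ e_j/r_j} S'^{(m)}_p(j)`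
  with the local factors (9.24) `S'^{(m)}_p(j) = 1` if `j = m` or `p ∣ a_j b_m − a_m b_j`
  (the prime cannot be moved into `d`), and otherwise `S' = 1 − p/φ_L(p)`, i.e. `0` if `p ∣ a_m`,
  `−1/(p − 1)` if `p ∤ a_m` (`sPrimeM_of_not`);
* `yVarM_eq_sum_yVar` — **display (9.23)**:
  `y^{(m)}_r = (r φ_ω(r)/φ_L(r)) ∑_{e ∈ 𝒟_k, r ∣ e} (y_e/φ_ω(e)) ∏_j ∏_{p ∣ e_j/r_j} S'^{(m)}_p(j)`.

(In the tree's encoding `dkBox` already carries Maynard's index-admissibility «`(e_j, W_j) = 1`», so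
his case `p ∣ W'_j/W_j` is the case `p ∣ a_j b_m − a_m b_j` here.) The remaining steps of Lemma 9.3
(Lemma 8.2 for `y_e − y_{r'}`, the `(s,t)` Euler product (9.27), Lemma 8.3 in `e_m`) are analytic.

## References
* J. Maynard, *Dense clusters of primes in subsets*, Compositio Math. 152 (2016), proof of Lemma 9.3
  p. 23, (9.23)–(9.24) [Maynard2016DenseClusters].
* K. Ford, B. Green, S. Konyagin, J. Maynard, T. Tao, *Long gaps between primes*, JAMS 31 (2018),
  Thm 6 (7.13) [FordGreenKonyaginMaynardTao2018].
-/

noncomputable section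

open Finset
open scoped ArithmeticFunction.Moebius

namespace Literature.NumberTheory.Sieve.FGKMT2018

variable {k : ℕ}

/-! ### The local factors `S'^{(m)}_p` and the inner divisor sum -/

/-- The local factor `S'^{(m)}_p(j)` of display (9.24) at a prime `p ∣ e_j/r_j`: `1` if the prime cannot
enter `d` (`j = m`, or `p ∣ a_j b_m − a_m b_j`), else `1 + μ(p)p/φ_L(p) = 1 − p/φ_L(p)`.
[cite: Maynard2016DenseClusters, proof of Lemma 9.3 p. 23, display (9.24)] -/
def sPrimeM (L : Fin k → ℤ × ℤ) (m j : Fin k) (p : ℕ) : ℝ :=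
  if j = m ∨ p ∣ (crossDet L m j).natAbs then 1 else 1 - (p : ℝ) / totForm (L m) p

/-- The three values of (9.24): for `j ≠ m`, `p ∤ a_j b_m − a_m b_j`:
`S'^{(m)}_p(j) = 0` if `p ∣ a_m` and `= −1/(p−1)` if `p ∤ a_m`.
[cite: Maynard2016DenseClusters, proof of Lemma 9.3 p. 23, display (9.24)] -/
theorem sPrimeM_of_not (L : Fin k → ℤ × ℤ) {m j : Fin k} (hl : (L m).1 ≠ 0) {p : ℕ} (hp : p.Prime)
    (h : ¬ (j = m ∨ p ∣ (crossDet L m j).natAbs)) :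
    sPrimeM L m j p = if p ∣ (L m).1.natAbs then 0 else -1 / ((p : ℝ) - 1) := by
  unfold sPrimeM
  rw [if_neg h, totForm_prime (L m) hl hp]
  have hp1 : (1 : ℝ) < p := by exact_mod_cast hp.one_lt
  split_ifs with hpa
  · rw [div_self (by positivity), sub_self]
  · have hne : (p : ℝ) - 1 ≠ 0 := by linarith
    field_simp
    ring

/-- The product of the local factors `∏_j ∏_{p ∣ e_j/r_j} S'^{(m)}_p(j)`.
[cite: Maynard2016DenseClusters, proof of Lemma 9.3 p. 23, display (9.23)] -/
def sPrimeProdM (L : Fin k → ℤ × ℤ) (m : Fin k) (r e : Fin k → ℕ) : ℝ :=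
  ∏ j, ∏ p ∈ (e j / r j).primeFactors, sPrimeM L m j p

/-- The inner divisor sum `∑_{d ∈ 𝒟'_k, d_m = 1, r ∣ d ∣ e} μ(d) d/φ_L(d)` of display (9.23).
[cite: Maynard2016DenseClusters, proof of Lemma 9.3 p. 23, display (9.23)] -/
def innerDSumM (L : Fin k → ℤ × ℤ) (B : ℕ) (R : ℝ) (m : Fin k) (r e : Fin k → ℕ) : ℝ :=
  ∑ d ∈ (dkBoxP L B R m).filter (fun d => (∀ i, r i ∣ d i) ∧ ∀ i, d i ∣ e i),
    ((μ (∏ i, d i) : ℤ) : ℝ) * (∏ i, d i : ℕ) / totForm (L m) (∏ i, d i)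

/-- The inner sum as a sum over all divisor vectors of `e` in `dkBox` with an indicator. [folklore] -/
private theorem innerDSumM_eq_sum_ite {L : Fin k → ℤ × ℤ} {B : ℕ} {R : ℝ} (m : Fin k)
    (r e : Fin k → ℕ) :
    innerDSumM L B R m r e =
      ∑ d ∈ (dkBox L B R).filter (fun d => ∀ i, d i ∣ e i),
        if d m = 1 ∧ (∀ j, j ≠ m → Nat.Coprime (d j) (crossDet L m j).natAbs) ∧ (∀ i, r i ∣ d i) then
          ((μ (∏ i, d i) : ℤ) : ℝ) * (∏ i, d i : ℕ) / totForm (L m) (∏ i, d i) else 0 := by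
  classical
  unfold innerDSumM
  rw [← Finset.sum_filter]
  refine Finset.sum_congr ?_ fun _ _ => rfl
  ext d
  simp only [Finset.mem_filter, mem_dkBoxP_iff]
  tauto

/-- **The inner divisor sum evaluates to `μ(r) r/φ_L(r) ∏_j ∏_{p ∣ e_j/r_j} S'^{(m)}_p(j)`**
(`r ∈ dkBoxP`, `e ∈ 𝒟_k`, `r ∣ e`; induction on `∏ eᵢ`, peeling one prime of `e/r` at a time).
[cite: Maynard2016DenseClusters, proof of Lemma 9.3 p. 23, displays (9.23)–(9.24)] -/
theorem innerDSumM_eq {L : Fin k → ℤ × ℤ} (hadm : FormsAdmissible L) {B : ℕ} {R : ℝ} {m : Fin k}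
    {r : Fin k → ℕ} (hr : r ∈ dkBoxP L B R m) :
    ∀ (N : ℕ) (e : Fin k → ℕ), e ∈ dkBox L B R → (∀ i, r i ∣ e i) → (∏ i, e i) = N →
      innerDSumM L B R m r e =
        ((μ (∏ i, r i) : ℤ) : ℝ) * (∏ i, r i : ℕ) / totForm (L m) (∏ i, r i) * sPrimeProdM L m r e := by
  classical
  have hl : (L m).1 ≠ 0 := hadm.1 m
  intro N
  induction N using Nat.strong_induction_on with
  | _ N ih =>
    intro e he hre heN
    have he1 : ∀ i, 1 ≤ e i := one_le_of_mem_dkBox he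
    have hesq : Squarefree (∏ i, e i) := squarefree_of_mem_dkBox he
    by_cases hcase : ∀ j, e j = r j
    · -- base: `e = r`, the inner sum is the single term `d = r`, the product is empty
      have her : e = r := funext hcase
      subst her
      have hset : (dkBoxP L B R m).filter (fun d => (∀ i, e i ∣ d i) ∧ ∀ i, d i ∣ e i) = {e} := by
        ext d
        simp only [Finset.mem_filter, Finset.mem_singleton]
        constructor
        · rintro ⟨-, h1, h2⟩
          exact funext fun i => Nat.dvd_antisymm (h2 i) (h1 i)
        · rintro rfl
          exact ⟨hr, fun i => dvd_rfl, fun i => dvd_rfl⟩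
      have hprod : sPrimeProdM L m e e = 1 := by
        unfold sPrimeProdM
        refine Finset.prod_eq_one fun j _ => ?_
        rw [Nat.div_self (he1 j), Nat.primeFactors_one, Finset.prod_empty]
      unfold innerDSumM
      rw [hset, Finset.sum_singleton, hprod, mul_one]
    · -- step: a coordinate `j` with `e_j ≠ r_j`; peel the least prime `p` of `e_j/r_j`
      obtain ⟨j, hj⟩ := not_forall.1 hcase
      have hq1 : e j / r j ≠ 1 := by
        intro h
        apply hj
        have := Nat.eq_mul_of_div_eq_right (hre j) h
        rw [this, mul_one]
      set p := (e j / r j).minFac with hpdef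
      have hp : p.Prime := Nat.minFac_prime hq1
      have hpq : p ∣ e j / r j := Nat.minFac_dvd _
      have hq0 : e j / r j ≠ 0 := by
        intro h
        rcases Nat.div_eq_zero_iff.1 h with h0 | hlt
        · exact absurd h0 (Nat.one_le_iff_ne_zero.1 (one_le_of_mem_dkBox (dkBoxP_subset L B R m hr) j))
        · exact absurd (Nat.le_of_dvd (he1 j) (hre j)) (not_le.2 hlt)
      have hmul : r j * p ∣ e j := by
        have h := Nat.mul_dvd_mul_left (r j) hpq
        rwa [Nat.mul_div_cancel' (hre j)] at h
      have hpej : p ∣ e j := (dvd_mul_left p (r j)).trans hmul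
      have hesqj : Squarefree (e j) :=
        hesq.squarefree_of_dvd (Finset.dvd_prod_of_mem e (Finset.mem_univ j))
      have hprj : ¬ p ∣ r j := by
        intro h
        have h2 : p * p ∣ e j := (Nat.mul_dvd_mul h (dvd_refl p)).trans hmul
        exact hp.not_isUnit (hesqj p h2)
      -- the peeled vector `e' = e/p@j`
      have he' := update_div_mem_dkBox he j hpej
      have hre' : ∀ i, r i ∣ Function.update e j (e j / p) i := by
        intro i
        by_cases hij : i = j
        · subst hij
          rw [Function.update_self]
          exact Nat.dvd_div_of_mul_dvd (by rw [mul_comm]; exact hmul)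
        · rw [Function.update_of_ne hij]; exact hre i
      have he'N : (∏ i, Function.update e j (e j / p) i) = N / p :=
        (Nat.div_eq_of_eq_mul_right hp.pos (by rw [mul_prod_update_div e j hpej, heN])).symm
      have hN0 : 0 < N := by rw [← heN]; exact Finset.prod_pos fun i _ => he1 i
      have IH := ih (N / p) (Nat.div_lt_self hN0 hp.one_lt) _ he' hre' he'N
      -- (a) the inner sum peels by the factor `S'^{(m)}_p(j)`
      have hsum : innerDSumM L B R m r e =
          sPrimeM L m j p * innerDSumM L B R m r (Function.update e j (e j / p)) := by
        rw [innerDSumM_eq_sum_ite m r e, innerDSumM_eq_sum_ite m r (Function.update e j (e j / p)),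
          sum_filter_dvd_eq_sum_add he hp hpej, Finset.mul_sum]
        refine Finset.sum_congr rfl fun d hd => ?_
        obtain ⟨hdbox, hde'⟩ := Finset.mem_filter.1 hd
        have hpd : ∀ i, ¬ p ∣ d i := not_dvd_of_dvd_update_div he hp hpej hde'
        -- the conditions for `d·p@j`
        have hcond : (Function.update d j (d j * p) m = 1 ∧
            (∀ j', j' ≠ m → Nat.Coprime (Function.update d j (d j * p) j') (crossDet L m j').natAbs) ∧
            ∀ i, r i ∣ Function.update d j (d j * p) i) ↔
            ((d m = 1 ∧ (∀ j', j' ≠ m → Nat.Coprime (d j') (crossDet L m j').natAbs) ∧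
              ∀ i, r i ∣ d i) ∧ ¬ (j = m ∨ p ∣ (crossDet L m j).natAbs)) := by
          constructor
          · rintro ⟨h1, h2, h3⟩
            have hjm : j ≠ m := by
              rintro rfl
              rw [Function.update_self] at h1
              exact hp.one_lt.ne' (Nat.eq_one_of_mul_eq_one_left h1)
            refine ⟨⟨by rwa [Function.update_of_ne (Ne.symm hjm)] at h1, fun j' hj' => ?_, fun i => ?_⟩,
              ?_⟩
            · have h := h2 j' hj'
              by_cases hjj : j' = j
              · subst hjj
                rw [Function.update_self] at h
                exact Nat.Coprime.coprime_dvd_left (dvd_mul_right _ _) h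
              · rwa [Function.update_of_ne hjj] at h
            · have h := h3 i
              by_cases hij : i = j
              · subst hij
                rw [Function.update_self] at h
                exact (Nat.Coprime.symm ((Nat.Prime.coprime_iff_not_dvd hp).2 hprj)).dvd_of_dvd_mul_right h
              · rwa [Function.update_of_ne hij] at h
            · rintro (h | h)
              · exact hjm h
              · have hc := h2 j hjm
                rw [Function.update_self] at hc
                have hg := Nat.dvd_gcd (dvd_mul_left p (d j)) h
                rw [hc.gcd_eq_one] at hg
                exact hp.one_lt.ne' (Nat.dvd_one.1 hg)
          · rintro ⟨⟨h1, h2, h3⟩, h4⟩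
            have hjm : j ≠ m := fun h => h4 (Or.inl h)
            have hpΔ : ¬ p ∣ (crossDet L m j).natAbs := fun h => h4 (Or.inr h)
            refine ⟨by rw [Function.update_of_ne (Ne.symm hjm)]; exact h1, fun j' hj' => ?_, fun i => ?_⟩
            · by_cases hjj : j' = j
              · subst hjj
                rw [Function.update_self]
                exact Nat.Coprime.mul_left (h2 _ hj') ((Nat.Prime.coprime_iff_not_dvd hp).2 hpΔ)
              · rw [Function.update_of_ne hjj]; exact h2 j' hj'
            · by_cases hij : i = j
              · subst hij
                rw [Function.update_self]
                exact (h3 _).trans (dvd_mul_right _ _)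
              · rw [Function.update_of_ne hij]; exact h3 i
        -- the value for `d·p@j`
        have hval : ((μ (∏ i, Function.update d j (d j * p) i) : ℤ) : ℝ) *
              (∏ i, Function.update d j (d j * p) i : ℕ) /
              totForm (L m) (∏ i, Function.update d j (d j * p) i) =
            -((p : ℝ) / totForm (L m) p) *
              (((μ (∏ i, d i) : ℤ) : ℝ) * (∏ i, d i : ℕ) / totForm (L m) (∏ i, d i)) := by
          have hd0 : (∏ i, d i) ≠ 0 :=
            Finset.prod_ne_zero_iff.2 fun i _ h0 => hpd i (h0 ▸ dvd_zero p)
          have hcop : p.Coprime (∏ i, d i) :=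
            Nat.Coprime.prod_right fun i _ => (Nat.Prime.coprime_iff_not_dvd hp).2 (hpd i)
          rw [moebius_prod_update_mul d j hp hpd, prod_update_mul,
            totForm_mul_of_coprime (L m) hl hp.ne_zero hd0 hcop]
          have h1 : totForm (L m) p ≠ 0 := (totForm_pos (L m) hl hp.ne_zero).ne'
          have h2 : totForm (L m) (∏ i, d i) ≠ 0 := (totForm_pos (L m) hl hd0).ne'
          push_cast
          field_simp
        by_cases hc : d m = 1 ∧ (∀ j', j' ≠ m → Nat.Coprime (d j') (crossDet L m j').natAbs) ∧
            ∀ i, r i ∣ d i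
        · rw [if_pos hc]
          by_cases h4 : j = m ∨ p ∣ (crossDet L m j).natAbs
          · have hn : ¬ (Function.update d j (d j * p) m = 1 ∧
                (∀ j', j' ≠ m → Nat.Coprime (Function.update d j (d j * p) j')
                  (crossDet L m j').natAbs) ∧ ∀ i, r i ∣ Function.update d j (d j * p) i) :=
              fun h => (hcond.1 h).2 h4
            rw [if_neg hn, add_zero]
            unfold sPrimeM
            rw [if_pos h4, one_mul]
          · rw [if_pos (hcond.2 ⟨hc, h4⟩), hval]
            unfold sPrimeM
            rw [if_neg h4]
            ring
        · rw [if_neg hc]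
          have hn : ¬ (Function.update d j (d j * p) m = 1 ∧
              (∀ j', j' ≠ m → Nat.Coprime (Function.update d j (d j * p) j')
                (crossDet L m j').natAbs) ∧ ∀ i, r i ∣ Function.update d j (d j * p) i) :=
            fun h => hc (hcond.1 h).1
          rw [if_neg hn, add_zero, mul_zero]
      -- (b) the product peels by the same factor
      have hprod : sPrimeProdM L m r e = sPrimeM L m j p * sPrimeProdM L m r (Function.update e j (e j / p)) := by
        unfold sPrimeProdM
        rw [← Finset.mul_prod_erase Finset.univ _ (Finset.mem_univ j),
          ← Finset.mul_prod_erase Finset.univ (fun j' => ∏ q ∈ (Function.update e j (e j / p) j' / r j').primeFactors,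
            sPrimeM L m j' q) (Finset.mem_univ j), Function.update_self, ← mul_assoc]
        congr 1
        · have hsqq : Squarefree (e j / r j) := hesqj.squarefree_of_dvd (Nat.div_dvd_of_dvd (hre j))
          have hdiv : e j / p / r j = e j / r j / p := by
            rw [Nat.div_div_eq_div_mul, mul_comm p (r j), ← Nat.div_div_eq_div_mul]
          rw [hdiv, primeFactors_div_of_squarefree hsqq hp hpq,
            ← Finset.mul_prod_erase _ _ (Nat.mem_primeFactors.2 ⟨hp, hpq, hq0⟩)]
        · refine Finset.prod_congr rfl fun j' hj' => ?_
          rw [Function.update_of_ne (Finset.ne_of_mem_erase hj')]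
      rw [hsum, IH, hprod]
      ring

/-- **Display (9.23)**: for `r ∈ 𝒟'_k` with `r_m = 1`,
`y^{(m)}_r = (r φ_ω(r)/φ_L(r)) ∑_{e ∈ 𝒟_k, r ∣ e} (y_e/φ_ω(e)) ∏_j ∏_{p ∣ e_j/r_j} S'^{(m)}_p(j)`.
[cite: Maynard2016DenseClusters, proof of Lemma 9.3 p. 23, displays (9.23)–(9.24); FordGreenKonyaginMaynardTao2018, Thm 6 (7.13)] -/
theorem yVarM_eq_sum_yVar {L : Fin k → ℤ × ℤ} (hadm : FormsAdmissible L) {B : ℕ} {R : ℝ}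
    (F : (Fin k → ℝ) → ℝ) {m : Fin k} {r : Fin k → ℕ} (hr : r ∈ dkBoxP L B R m) :
    yVarM L B R F m r =
      (∏ i, r i : ℕ) * phiOmega L (∏ i, r i) / totForm (L m) (∏ i, r i) *
        ∑ e ∈ (dkBox L B R).filter (fun e => ∀ i, r i ∣ e i),
          yVar L B R F e / phiOmega L (∏ i, e i) * sPrimeProdM L m r e := by
  classical
  -- Step 1: substitute (8.6) and swap the `d`- and `e`-sums
  have h1 : yVarM L B R F m r = ((μ (∏ i, r i) : ℤ) : ℝ) * phiOmega L (∏ i, r i) *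
      ∑ e ∈ (dkBox L B R).filter (fun e => ∀ i, r i ∣ e i),
        yVar L B R F e / phiOmega L (∏ i, e i) * innerDSumM L B R m r e := by
    unfold yVarM
    congr 1
    have hterm : ∀ d ∈ (dkBoxP L B R m).filter (fun d => ∀ i, r i ∣ d i),
        lamVar L B R F d / totForm (L m) (∏ i, d i) =
          ∑ e ∈ (dkBox L B R).filter (fun e => ∀ i, d i ∣ e i),
            yVar L B R F e / phiOmega L (∏ i, e i) *
              (((μ (∏ i, d i) : ℤ) : ℝ) * (∏ i, d i : ℕ) / totForm (L m) (∏ i, d i)) := by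
      intro d _
      unfold lamVar
      rw [mul_div_right_comm, Finset.mul_sum]
      refine Finset.sum_congr rfl fun e _ => ?_
      push_cast
      ring
    rw [Finset.sum_congr rfl hterm]
    unfold innerDSumM
    simp_rw [Finset.mul_sum]
    refine Finset.sum_comm' fun d e => ?_
    simp only [Finset.mem_filter]
    constructor
    · rintro ⟨⟨hdP, hrd⟩, hebox, hde⟩
      exact ⟨⟨hdP, hrd, hde⟩, hebox, fun i => (hrd i).trans (hde i)⟩
    · rintro ⟨⟨hdP, hrd, hde⟩, hebox, -⟩
      exact ⟨⟨hdP, hrd⟩, hebox, hde⟩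
  rw [h1, Finset.mul_sum, Finset.mul_sum]
  refine Finset.sum_congr rfl fun e he => ?_
  obtain ⟨hebox, hre⟩ := Finset.mem_filter.1 he
  rw [innerDSumM_eq hadm hr _ e hebox hre rfl]
  have hμ2 : ((μ (∏ i, r i) : ℤ) : ℝ) * ((μ (∏ i, r i) : ℤ) : ℝ) = 1 := by
    have h := ArithmeticFunction.moebius_sq_eq_one_of_squarefree
      (squarefree_of_mem_dkBox (dkBoxP_subset L B R m hr))
    rw [← pow_two]
    exact_mod_cast h
  have hre : ((μ (∏ i, r i) : ℤ) : ℝ) * phiOmega L (∏ i, r i) *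
      (yVar L B R F e / phiOmega L (∏ i, e i) *
        (((μ (∏ i, r i) : ℤ) : ℝ) * (∏ i, r i : ℕ) / totForm (L m) (∏ i, r i) * sPrimeProdM L m r e)) =
      ((μ (∏ i, r i) : ℤ) : ℝ) * ((μ (∏ i, r i) : ℤ) : ℝ) *
        ((∏ i, r i : ℕ) * phiOmega L (∏ i, r i) / totForm (L m) (∏ i, r i) *
          (yVar L B R F e / phiOmega L (∏ i, e i) * sPrimeProdM L m r e)) := by ring
  rw [hre, hμ2, one_mul]

end Literature.NumberTheory.Sieve.FGKMT2018
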